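import Summits.RiemannHypothesis.RiemannHypothesis.Theses.LeeYang
import Literature.NumberTheory.LFunctions.LagariasXiShiftHermiteBiehlerProofs

/-!
# Sketch — crux-ideate `stmt-RiemannHypothesis-0451` (`LeeyangThesis`), ideator 2, round 1

First-lemma signatures for the two idea cards (they only need to ELABORATE; `sorry` allowed):

* card `universal-factor-rungs`: ghost-spin decoration (`cosh(l u)`) and rank-one tilt
  (`e^{t u²}`) preserve `IsIsingLimitLaw`; hence the RH-free rungs `GhostRung l` (l ≥ 1, Lee–Yang by
  Lagarias 2005 Lemma 2.1 = tree theorem `lagarias2005_lemma_2_1_holds`) and `TiltRung t`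
  (t ≥ 1/2, Lee–Yang by de Bruijn 1950) are NECESSARY for X, and X is their limit `l, t ↓ 0`.
* card `harmonic-skeleton-dressing`: the free Bernoulli convolution with weights `1/(4k)`, `k ≥ 6`,
  is an Ising limit law matching Ξ's analytic class; X⁺ = "some ferromagnetic dressing of that
  skeleton converges to ν_Φ" implies X.
-/

noncomputable section

open MeasureTheory Filter Topology
open scoped ENNReal

namespace Summit.RiemannHypothesis.RiemannHypothesis.Cruxes.LeeyangThesis.Ideas

open Literature.Probability.LatticeModels Literature.NumberTheory.LFunctions
open Summit.RiemannHypothesis.RiemannHypothesis.Theses.LeeYang (LeeyangThesis)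

/-! ## Card 1 — universal-factor rungs -/

/-- The ghost-decorated de Bruijn density `cosh(l u) · Φ(u)` (one extra spin of weight `0`
coupled to the magnetisation with strength `l`). -/
def ghostDensity (l : ℝ) (u : ℝ) : ℝ := Real.cosh (l * u) * deBruijnPhi u

/-- The over-tilted de Bruijn density `e^{t u²} · Φ(u)` (rank-one ferromagnetic coupling shift
`J + t w ⊗ w`, tree: `integral_isingMagnetizationLaw_add_rankOne`). -/
def tiltDensity (t : ℝ) (u : ℝ) : ℝ := Real.exp (t * u ^ 2) * deBruijnPhi u

/-- Rung `G(l)`: the probability law `∝ cosh(l u) Φ(u) du` is an Ising limit law. `G(0)` is X. -/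
def GhostRung (l : ℝ) : Prop :=
  ∀ ν : ProbabilityMeasure ℝ, (ν : Measure ℝ) =
      (∫⁻ u, ENNReal.ofReal (ghostDensity l u))⁻¹ •
        volume.withDensity (fun u => ENNReal.ofReal (ghostDensity l u)) →
    IsIsingLimitLaw ν

/-- Rung `T(t)`: the probability law `∝ e^{t u²} Φ(u) du` is an Ising limit law. `T(0)` is X. -/
def TiltRung (t : ℝ) : Prop :=
  ∀ ν : ProbabilityMeasure ℝ, (ν : Measure ℝ) =
      (∫⁻ u, ENNReal.ofReal (tiltDensity t u))⁻¹ •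
        volume.withDensity (fun u => ENNReal.ofReal (tiltDensity t u)) →
    IsIsingLimitLaw ν

/-- **First lemma (card 1, finite form).** Adding one site of weight `0`, coupled to site `i` with
`J'_{0i} = J'_{i0} = l wᵢ / 2 ≥ 0`, multiplies the Gibbs weight of every configuration of the old
sites by `2 cosh(l · M)`: the new magnetisation law is the `cosh(l u)`-tilt of the old one. -/
theorem exists_isingMagnetizationLaw_eq_cosh_tilt {n : ℕ} {J : Fin n → Fin n → ℝ} {w : Fin n → ℝ}
    (hJ : ∀ i j, 0 ≤ J i j) (hw : ∀ i, 0 ≤ w i) {l : ℝ} (hl : 0 ≤ l) :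
    ∃ (J' : Fin (n + 1) → Fin (n + 1) → ℝ) (w' : Fin (n + 1) → ℝ),
      (∀ i j, 0 ≤ J' i j) ∧ (∀ i, 0 ≤ w' i) ∧
        ∀ f : ℝ → ℝ, Continuous f →
          ∫ u, f u ∂(isingMagnetizationLaw (n + 1) J' w' : Measure ℝ) =
            (∫ u, Real.cosh (l * u) ∂(isingMagnetizationLaw n J w : Measure ℝ))⁻¹ *
              ∫ u, Real.cosh (l * u) * f u ∂(isingMagnetizationLaw n J w : Measure ℝ) := by
  sorry

/-- **First lemma (card 1, limit form): `IsIsingLimitLaw` is closed under ghost-spin decoration.**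
If `ν` is an Ising limit law and `l ≥ 0` then so is `cosh(l u) ν(du) / ∫cosh(l u) dν`
(finite form above along a witness sequence; weak convergence of the tilted laws from the uniform
`e^{bu²}`-moment bounds, which also persist). Pólya's universal factor `cosh` is ferromagnetic. -/
theorem isIsingLimitLaw_cosh_tilt (ν : ProbabilityMeasure ℝ) (hν : IsIsingLimitLaw ν)
    {l : ℝ} (hl : 0 ≤ l) (ν' : ProbabilityMeasure ℝ)
    (h : (ν' : Measure ℝ) =
      (∫⁻ u, ENNReal.ofReal (Real.cosh (l * u)) ∂(ν : Measure ℝ))⁻¹ •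
        (ν : Measure ℝ).withDensity (fun u => ENNReal.ofReal (Real.cosh (l * u)))) :
    IsIsingLimitLaw ν' := by
  sorry

/-- The same for the Gaussian over-tilt `e^{t u²}`, `t ≥ 0` (rank-one coupling shift; the finite
form IS the tree's `integral_isingMagnetizationLaw_add_rankOne`). -/
theorem isIsingLimitLaw_gauss_tilt (ν : ProbabilityMeasure ℝ) (hν : IsIsingLimitLaw ν)
    {t : ℝ} (ht : 0 ≤ t) (ν' : ProbabilityMeasure ℝ)
    (h : (ν' : Measure ℝ) =
      (∫⁻ u, ENNReal.ofReal (Real.exp (t * u ^ 2)) ∂(ν : Measure ℝ))⁻¹ •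
        (ν : Measure ℝ).withDensity (fun u => ENNReal.ofReal (Real.exp (t * u ^ 2)))) :
    IsIsingLimitLaw ν' := by
  sorry

/-- **X is the `l ↓ 0` / `t ↓ 0` limit of its RH-free rungs.** (`→`: the two closure lemmas;
`←`: `IsIsingLimitLaw` is closed under weak limits with uniform Gaussian moments, and
`cosh(l u)Φ/Z_l → Φ/Z`, `e^{tu²}Φ/Z_t → Φ/Z` as `l, t ↓ 0`, with `∫e^{bu²}` bounded uniformly.) -/
theorem leeyangThesis_iff_forall_ghostRung : LeeyangThesis ↔ ∀ l : ℝ, 0 < l → GhostRung l := by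
  sorry

theorem leeyangThesis_iff_forall_tiltRung : LeeyangThesis ↔ ∀ t : ℝ, 0 < t → TiltRung t := by
  sorry

/-- Monotonicity of the tilt ladder (from `isIsingLimitLaw_gauss_tilt`): `{t | T(t)}` is an
up-set. -/
theorem tiltRung_mono {t t' : ℝ} (htt' : t ≤ t') (ht : TiltRung t) : TiltRung t' := by
  sorry

/-- **The Griffiths–Simon constant of `Ξ`**: `t_𝒢 := inf {t | e^{tu²}Φ du is an Ising limit law}`
(`= +∞`-avatar: the set may be empty — that is the first rung to settle). Since Ising limit laws
are Lee–Yang (`hasLeeYangProperty_of_isIsingLimitLaw_holds`), `Λ_DN ≤ t_𝒢`; and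
`X ↔ t_𝒢 ≤ 0 ↔ t_𝒢 = 0` by `rodgers_tao`. -/
def griffithsSimonConst : ℝ := sInf {t : ℝ | TiltRung t}

/-- Every tilt rung forces real zeros of de Bruijn's `H_t` (so `Λ_DN ≤ t_𝒢`). -/
theorem hasOnlyRealZeros_deBruijnH_of_tiltRung {t : ℝ} (ht : TiltRung t) :
    HasOnlyRealZeros (deBruijnH t) := by
  sorry

/-- **Lee–Yang of the ghost rungs is a THEOREM for `l ≥ 1`** (RH-free): the Laplace transform of
`cosh(l u)Φ(u) du` is `[ξ(½ + l/2 + z/2) + ξ(½ − l/2 + z/2)]/8` (`integral_exp_mul_deBruijnPhi`,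
`deBruijnH_zero_eq_holds`), i.e. Lagarias' differenced `ξ`; for `l/2 ≥ 1/2` its zeros are purely
imaginary by `lagarias2005_lemma_2_1_holds` (Hermite–Biehler: `|ξ(h+s)| > |ξ(h+1−s̄)|`, `Re s > ½`)
plus the functional equation and `ξ(s̄) = conj ξ(s)`. -/
theorem hasLeeYangProperty_ghostDensity {l : ℝ} (hl : 1 ≤ l) :
    HasLeeYangProperty (volume.withDensity fun u => ENNReal.ofReal (ghostDensity l u)) := by
  sorry

/-- Lee–Yang of the tilt rungs for `t ≥ 1/2` is de Bruijn's theorem (tree fact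
`hasOnlyRealZeros_deBruijnH_one_half` + `HasOnlyRealZeros.mono_deBruijnH`). -/
theorem hasLeeYangProperty_tiltDensity (hdB : hasOnlyRealZeros_deBruijnH_one_half)
    (hmono : HasOnlyRealZeros.mono_deBruijnH) {t : ℝ} (ht : 1 / 2 ≤ t) :
    HasLeeYangProperty (volume.withDensity fun u => ENNReal.ofReal (tiltDensity t u)) := by
  sorry

/-! ## Card 2 — harmonic skeleton dressing -/

/-- Harmonic weights `w_k = 1/(4(k + K))`, `k = 0, …, n−1` (the spins `K, K+1, …` of the random
harmonic series, scaled by `1/4` to match the double-exponential rate `e^{4|u|}` of `Φ`). -/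
def harmonicWeight (K n : ℕ) : Fin n → ℝ := fun k => 1 / (4 * ((k : ℝ) + K))

/-- The free (J = 0) harmonic skeleton law: law of `Σ_{k<n} σ_k /(4(k+K))`, independent fair spins. -/
def harmonicSkeletonLaw (K n : ℕ) : ProbabilityMeasure ℝ :=
  isingMagnetizationLaw n (fun _ _ => 0) (harmonicWeight K n)

/-- **First lemma (card 2).** The free harmonic skeleton converges (three-series theorem,
`Σ w_k² < ∞`) to an Ising limit law `ρ_K` with `∫ e^{bu²} dρ_K < ∞` for every `b` — indeed with
doubly-exponential tails `ρ_K(|u| > x) ≤ exp(−c K e^{4x})` (to exceed `x` the first `≈ K e^{4x}`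
signs must align) — whose Laplace transform `∏_{k ≥ K} cosh(h/(4k))` is entire of order 1 and
maximal type with zeros exactly at `h = ±2πi·k(2m−1)`, `k ≥ K`, `m ≥ 1`
(counting function `(Y/4π) log Y + O(Y)`, the Riemann–von Mangoldt main term). -/
theorem exists_tendsto_harmonicSkeletonLaw (K : ℕ) (hK : 1 ≤ K) :
    ∃ ρ : ProbabilityMeasure ℝ, Tendsto (fun n => harmonicSkeletonLaw K n) atTop (𝓝 ρ) ∧
      IsIsingLimitLaw ρ ∧
      (∀ b : ℝ, Integrable (fun u => Real.exp (b * u ^ 2)) (ρ : Measure ℝ)) ∧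
      ∀ z : ℂ, (∫ u, Complex.exp (z * u) ∂(ρ : Measure ℝ)) = 0 ↔
        ∃ (k m : ℕ), K ≤ k ∧ (z = 2 * Real.pi * Complex.I * k * (2 * m + 1) ∨
          z = -(2 * Real.pi * Complex.I * k * (2 * m + 1))) := by
  sorry

/-- **X⁺ (card 2's transfer, STRONGER than X): the harmonic dressing conjecture.** There is ONE
weight sequence `w_k ≥ 0` with the harmonic profile `k · w_k → 1/4` (forced by the double-exponential
rate `e^{4|u|}` of `Φ` and by the Riemann–von Mangoldt main term `(Y/4π) log Y` of the zero count)
and ferromagnetic couplings `J⁽ⁿ⁾ ≥ 0` on its first `n` spins whose magnetisation laws converge,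
with uniform Gaussian moments, to the de Bruijn law `ν_Φ`. (Working values from the card's numerics:
`w_k = 0`, `k ≤ 5`; `w_k ≈ 0.9/(4k)`, `k ≥ 6`.) -/
def HarmonicDressing : Prop :=
  ∃ (w : ℕ → ℝ) (J : ∀ n : ℕ, Fin n → Fin n → ℝ), (∀ k, 0 ≤ w k) ∧
    Tendsto (fun k : ℕ => (k : ℝ) * w k) atTop (𝓝 (1 / 4)) ∧ (∀ n i j, 0 ≤ J n i j) ∧
    ∀ ν : ProbabilityMeasure ℝ, (ν : Measure ℝ) =
        (∫⁻ u, ENNReal.ofReal (deBruijnPhi u))⁻¹ •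
          volume.withDensity (fun u => ENNReal.ofReal (deBruijnPhi u)) →
      Tendsto (fun n => isingMagnetizationLaw n (J n) (fun i : Fin n => w i)) atTop (𝓝 ν) ∧
        ∀ b : ℝ, ∃ C : ℝ, ∀ n,
          ∫ u, Real.exp (b * u ^ 2) ∂(isingMagnetizationLaw n (J n) (fun i : Fin n => w i) : Measure ℝ) ≤ C

/-- `X⁺ → X`, by the definition of `IsIsingLimitLaw`. -/
theorem leeyangThesis_of_harmonicDressing (h : HarmonicDressing) : LeeyangThesis := by
  obtain ⟨w, J, hw, -, hJ, hconv⟩ := h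
  intro ν hν
  obtain ⟨hT, hmom⟩ := hconv ν hν
  exact ⟨fun n => n, fun n => J n, fun n => fun i : Fin n => w i, fun n => hJ n,
    fun n i => hw i, hT, hmom⟩

/-- **Necessary inequalities any dressing must respect** (both hold numerically for the working
skeleton, see the card): GKS II — couplings only INCREASE `⟨M²⟩`, so `Σ_k w_k² ≤ Var ν_Φ = 0.011552`;
Camia–Jiang–Newman 2023 Thm 2 (tree fact file `LeeYangFirstZeroMonotone`) — couplings only DECREASE the
first Lee–Yang zero, so `2γ₁ = 28.269 ≤ π/(2 max_k w_k)`. The variance half, for any dressing: -/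
theorem tsum_sq_le_variance_of_harmonicDressing (h : HarmonicDressing) :
    ∃ (w : ℕ → ℝ), (Tendsto (fun k : ℕ => (k : ℝ) * w k) atTop (𝓝 (1 / 4))) ∧
      (∑' k : ℕ, w k ^ 2) ≤
        (∫⁻ u, ENNReal.ofReal (deBruijnPhi u))⁻¹.toReal * ∫ u, u ^ 2 * deBruijnPhi u := by
  sorry

end Summit.RiemannHypothesis.RiemannHypothesis.Cruxes.LeeyangThesis.Ideas
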